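import Literature.Probability.RandomPlanarGeometry.SAWQuarticConnectiveConstantLower
import HarnessLib

/-!
# `μ(ℤ⁴) > 5.94`: the irreducible-bridge certificate of `SAWQuarticConnectiveConstantLower.lean` at length `10`

Topic `Literature/Probability/RandomPlanarGeometry` (continues `SAWQuarticConnectiveConstantLower.lean`: the eight-letter word model of
`ℤ⁴`, the verified acceptance test `QuarticIrrCert.WordOK`, the list certificate `QuarticIrrCert.certL` with its soundness
`QuarticIrrCert.le_of_certL` (standard axioms), the untrusted half-space search `QuarticIrrCert.dfs`, and the certified counts
`λ_n(ℤ⁴)` for `n ≤ 9`). One more evaluation, `λ_10(ℤ⁴) ≥ 2553594` (the exact value), kept in its own file because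
its `native_decide` is the expensive one, and the resulting numeral: `Σ_{n ≤ 10} λ_n(ℤ⁴) (50/297)^n > 1`, hence
**`μ(ℤ⁴) > 297/50 = 5.94`** by Kesten's inequality `Σ_n λ_n μ^{-n} ≤ 1`
(`Zd.inv_lt_connectiveConstant_of_one_lt_sum`; tree so far `5.87`; the truncation at `n ≤ 10` cannot certify `5.95`, its root is `5.9448`). This bound is weaker than
print (Hara–Slade–Sokal 1993) but kernel-checked. Computational class: axioms standard plus the `native_decide` count
certificates (`Lean.ofReduceBool`).
-/

open Finset Literature.Probability.LatticeModels
open scoped BigOperators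

namespace Literature.Probability.RandomPlanarGeometry.SAW.Zd

namespace QuarticIrrCert

/-! ### The evaluation at `n = 10` (computational class) -/

/-- `λ_10(ℤ⁴) ≥ 2553594`. [cite: Jensen2004SAWLowerBounds, §2] [cite: MadrasSlade1993, Definition 4.2.1 (p. 89)] -/
theorem le_lambda_ten : 2553594 ≤ irreducibleBridgeCount 4 10 := le_of_certL (L := dfs 10) (by native_decide)

end QuarticIrrCert

/-! ### The numeral -/

open QuarticIrrCert in
/-- **`μ(ℤ⁴) > 5.94`**: `297/50 < connectiveConstant 4`, from `Σ_{n ≤ 10} λ_n(ℤ⁴) (50/297)^n > 1` and Kesten's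
inequality. [cite: MadrasSlade1993, Table 1.1 (p. 12), d = 4 row; §4.2, eq. (4.2.3)–(4.2.4) (pp. 90–91)]
[cite: HaraSladeSokal1993, Table 1 (p. 3) and Table 2 (p. 12)] [cite: Kesten1963SAW, §4]
[cite: Jensen2004SAWLowerBounds, §2 (Kesten's truncation principle)] -/
theorem connectiveConstant_four_gt_297_div_50 : (297 : ℝ) / 50 < connectiveConstant 4 := by
  have hx : (0 : ℝ) < 50 / 297 := by norm_num
  have key : (1 : ℝ) < ∑ k ∈ Finset.range 11, (irreducibleBridgeCount 4 k : ℝ) * (50 / 297) ^ k := by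
    have h1 : (1 : ℝ) ≤ irreducibleBridgeCount 4 1 := by exact_mod_cast le_lambda_one
    have h2 : (6 : ℝ) ≤ irreducibleBridgeCount 4 2 := by exact_mod_cast le_lambda_two
    have h3 : (30 : ℝ) ≤ irreducibleBridgeCount 4 3 := by exact_mod_cast le_lambda_three
    have h4 : (150 : ℝ) ≤ irreducibleBridgeCount 4 4 := by exact_mod_cast le_lambda_four
    have h5 : (726 : ℝ) ≤ irreducibleBridgeCount 4 5 := by exact_mod_cast le_lambda_five
    have h6 : (3564 : ℝ) ≤ irreducibleBridgeCount 4 6 := by exact_mod_cast le_lambda_six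
    have h7 : (17526 : ℝ) ≤ irreducibleBridgeCount 4 7 := by exact_mod_cast le_lambda_seven
    have h8 : (89094 : ℝ) ≤ irreducibleBridgeCount 4 8 := by exact_mod_cast le_lambda_eight
    have h9 : (466824 : ℝ) ≤ irreducibleBridgeCount 4 9 := by exact_mod_cast le_lambda_nine
    have h10 : (2553594 : ℝ) ≤ irreducibleBridgeCount 4 10 := by exact_mod_cast le_lambda_ten
    simp only [Finset.sum_range_succ, Finset.sum_range_zero, irreducibleBridgeCount_zero]
    generalize irreducibleBridgeCount 4 1 = a1 at h1 ⊢
    generalize irreducibleBridgeCount 4 2 = a2 at h2 ⊢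
    generalize irreducibleBridgeCount 4 3 = a3 at h3 ⊢
    generalize irreducibleBridgeCount 4 4 = a4 at h4 ⊢
    generalize irreducibleBridgeCount 4 5 = a5 at h5 ⊢
    generalize irreducibleBridgeCount 4 6 = a6 at h6 ⊢
    generalize irreducibleBridgeCount 4 7 = a7 at h7 ⊢
    generalize irreducibleBridgeCount 4 8 = a8 at h8 ⊢
    generalize irreducibleBridgeCount 4 9 = a9 at h9 ⊢
    generalize irreducibleBridgeCount 4 10 = a10 at h10 ⊢
    push_cast
    norm_num
    linarith [h1, h2, h3, h4, h5, h6, h7, h8, h9, h10]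
  have := inv_lt_connectiveConstant_of_one_lt_sum 4 _ hx key
  rwa [inv_div] at this

end Literature.Probability.RandomPlanarGeometry.SAW.Zd
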